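import Literature.NumberTheory.EllipticCurves.NewformDistinguishingPrimeGRH
import Literature.NumberTheory.EllipticCurves.ModularMethodEpsShapeBoundProofs
import Literature.NumberTheory.EllipticCurves.PastenValuationProductThm75AsymptoticProofs
import HarnessLib

/-!
# Pasten's GRH-conditional bounds: Thm 7.4 (`D = 1`), the GRH clauses of Thm 7.5, and the
# `abc` translation `log c ≪ rad · log log rad` — PROVED from Thm 7.3 over the tree

Topic `Literature/NumberTheory/EllipticCurves` (family `abc`, LADDER-ABC A1, the *modular method*;
cell abc-stewartyu, seat lit-abc-pasten g4). Theorems only — NO new statement, NO new named fact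
(D-0026); the proofs companion of `NewformDistinguishingPrimeGRH.lean` (named fact
`PastenShimura2024_thm_7_3`: under GRH for `L(s, f ⊗ f)`, `L(s, f ⊗ g)` two weight-`2` newforms of
level dividing `N` differ at a prime `p < C (log N)²`, `p ∤ N`). Source: H. Pasten, *Shimura curves and
the abc conjecture*, J. Number Theory **254** (2024) 214–335 = arXiv:1705.09251v4 [`PastenShimura2024`],
§7.3–§7.4 (arXiv pp. 26–27), read in the held TeX:

> **Theorem 7.4.** Suppose that the Generalized Riemann Hypothesis for Rankin–Selberg `L`-functions of
> modular forms holds. Let `ε > 0`. Then for `N ≫_ε 1` with an effective implicit constant, we have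
> `log δ_{D,M} ≤ (1/12 + ε) φ(D) M log log N`.
> *Proof.* The proof is similar to that of Theorem 7.2, except that we replace the integer `n_c` by
> the prime `p_{f,g}`, with `c`, `f` and `g` as in the cited proof, and `p_{f,g}` as in Theorem 7.3.
>
> **Theorem 7.5** (last display). Finally, if we assume GRH, for `N ≫_ε 1` with an effective implicit
> constant we have `h(E) < (1/24 + ε) N log log N` and `log |Δ_E| < (1/2 + ε) N log log N`.

## What this file proves (all at `D = 1`, `M = N`, i.e. `φ(D)M = N`, the classical modular curve)

* `Pasten2024.exists_log_modularDegree_le_loglog_of_thm_7_3` — the engine: an absolute `K ≥ 0` with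
  `log δ_{1,N} ≤ (1/12) N log log N + K N` for every optimal datum at a level `N ≥ 16` at which GRH
  holds for the pairs (newform of level `N`, newform of level `M ∣ N`). Printed proof of Thm 7.2/7.4
  run over the tree's PROVED §7.2 engine: Thm 5.5 (`PastenShimura2024_thm_5_5_holds`, Riemann's
  period relations) gives `log δ_{1,N} ≤ Σ_{c ≠ [χ₀]} log η(c)`; for each class,
  `η(c) ≤ (2√p + |a_p(f)|)^{#c} ≤ (4√p)^{#c}` at a distinguishing prime `p ≤ X`
  (`Pasten2024.log_modularDegree_le_card_mul_of_distinguishingIndex`, with the weight-`2` Hasse–Weil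
  bound `Deligne1974_heckeT_eigenvalue_norm_le.weight_two`), here `X = C (log N)²` from Thm 7.3
  (`PastenShimura2024_thm_7_3.exists_distinguishingIndex_le`); the class count
  `Σ_{c ≠ [χ₀]} #c ≤ N/12 + (25/12) d(N)³ √N` (`MurtyPasten.sum_erase_finrank_quotient_le_explicit`:
  Atkin–Lehner count, Möbius inversion, genus formula — the tree's PROVED form of Prop 7.1) and the
  divisor bound `d(N) ≪ N^{1/12}` (`Sieve.exists_card_divisors_le_mul_rpow'`) absorb everything but
  the main term into `K N`.
* `PastenShimura2024_thm_7_4_levelOne` — **Thm 7.4 at `D = 1`**: for every `ε > 0` there is `N₁`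
  with `log δ_{1,N} < (1/12 + ε) N log log N` for all `N ≥ N₁` at which GRH holds (as above), and
  `PastenShimura2024_thm_7_4_levelOne_of_grh` — the same under GRH for all pairs of weight-`2` newforms.
* `PastenShimura2024_thm_7_5_grh` — **the GRH clauses of Thm 7.5**: under GRH for the Rankin–Selberg
  `L`-functions of all pairs of weight-`2` newforms, for every `ε > 0` and every `E/ℚ` of conductor
  `N ≥ N₀(ε)`: `h(E) < (1/24 + ε) N log log N` and `log|Δ_E| < (1/2 + ε) N log log N`; from
  modularity with an integral Manin constant (`nonempty_modularParametrizationData`), Mazur–Kenku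
  (`PastenShimura2024_minimalDegree_le_163_mul`), Deligne's bound (weight `2`) and Thm 7.3, through the
  tree's (EqHDeg) `faltingsHeight_le_of_class_bound` and (EqDiscH)
  `log_minimalDiscriminantNorm_le_of_modularity'` / `log_minModularDegree_le_of_class_bound` on a
  global minimal model — verbatim the §7.4 deduction, as in the unconditional siblings
  `MurtyPasten.height_discriminant_asymptotic_of_modularity_mazurKenku` /
  `PastenShimura2024_thm_7_5_height_of_thm_7_2`.
* `exists_abc_log_le_of_discriminant_loglogBound` — the Frey–Hellegouarch translation of ANY bound
  `log|Δ_min(E)| ≤ A · N_E log log N_E` (`N_E ≥ N₀`): `log c ≤ (1 + 1024 A) · rad(abc) · log log rad(abc)`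
  for all `abc` triples with `c ≥ c₀` (as `epsShapeBound_one_of_discriminant_levelBound`: the Frey model
  of `exists_frey_model_sq_dvd` has `N ∣ 2¹⁰ rad`, `(abc)² ∣ 2⁸ Δ_min`; a prime `p ≥ 2 max(N₀+2, 512)`
  of `abc` forces `N ≥ N₀` and `rad ≥ 1024`, whence `log log N ≤ 2 log log rad`; the finitely many
  triples with all primes small — Mahler, `finite_setOf_isABCTriple_primeFactors_subset_holds` — are
  excluded by `c₀`).
* `abc_log_le_mul_rad_mul_loglog_of_grh` — **the conditional rung A1.P(GRH) of the cell's idea card**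
  (HOME/lit-abc-pasten/IDEA-A1P-modular-method-rung.md, "A1.P(GRH): `log c ≤ κ R log log R` from
  Pasten Thm 7.4"): under GRH for Rankin–Selberg `L`-functions of weight-`2` newforms, with modularity,
  Mazur–Kenku, Deligne (weight `2`) and Thm 7.3, there are `K, c₀` with
  `log c ≤ K · rad(abc) · log log rad(abc)` for every `abc` triple with `c ≥ c₀` (`K = 1537`).

Trust base of the last theorem: {`nonempty_modularParametrizationData` (Modularity Theorem),
`PastenShimura2024_minimalDegree_le_163_mul` (Mazur–Kenku), `Deligne1974_heckeT_eigenvalue_norm_le`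
(weight-`2` case = Hasse–Weil), `PastenShimura2024_thm_7_3` (Iwaniec–Kowalski Prop. 5.22)} + the GRH
HYPOTHESIS `RankinSelbergGRH`. WHAT THIS IS NOT: nothing about GRH is asserted; the bound is still
exponential in `rad(abc)` (it sits between the unconditional modular-method rung `log c ≪ rad log rad`
and any `EpsShapeBound θ`, `θ < 1`, and is far above the REACHED unconditional `EpsShapeBound (2/3)`);
no claim on `abc`; the `D > 1` clauses of Thms 7.4/7.7 and Cor 7.8 (GRH lines) are NOT here (no
carrier for the Jacquet–Langlands class count on `𝕋_{D,M}`); constants `K`, `N₀`, `c₀` are ours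
(Pasten's implicit constants are not printed).

## References

* [PastenShimura2024] H. Pasten, J. Number Theory 254 (2024) = arXiv:1705.09251v4: Prop. 7.1, Thm 7.2
  and its proof (p. 26), §7.3 Thm 7.3, Thm 7.4 and §7.4 Thm 7.5 (p. 27), §3 (3.1)–(3.2) (p. 13).
* [IwaniecKowalski2004] H. Iwaniec, E. Kowalski, *Analytic Number Theory*, Prop. 5.22.
* [MurtyPasten2013] M. R. Murty, H. Pasten, J. Number Theory 133 (2013), §8 (the Frey translation).
-/

noncomputable section

open scoped MatrixGroups ModularForm

open WeierstrassCurve CongruenceSubgroup UpperHalfPlane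

namespace Literature.NumberTheory.EllipticCurves

open ModularForms Pasten2024 DiophantineGeometry

/-! ### Real-arithmetic helpers -/

/-- `log log N → ∞`: for every `T` there is `N₁` with `T < log log N` for all `N ≥ N₁`. [folklore] -/
private theorem exists_nat_lt_loglog (T : ℝ) :
    ∃ N₁ : ℕ, ∀ N : ℕ, N₁ ≤ N → T < Real.log (Real.log (N : ℝ)) := by
  refine ⟨⌈Real.exp (Real.exp T)⌉₊ + 1, fun N hN => ?_⟩
  have hN' : Real.exp (Real.exp T) < (N : ℝ) := by
    have h1 : Real.exp (Real.exp T) ≤ (⌈Real.exp (Real.exp T)⌉₊ : ℝ) := Nat.le_ceil _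
    have h2 : ((⌈Real.exp (Real.exp T)⌉₊ + 1 : ℕ) : ℝ) ≤ N := by exact_mod_cast hN
    push_cast at h2
    linarith
  have hNpos : (0 : ℝ) < N := lt_trans (Real.exp_pos _) hN'
  have hlog : Real.exp T < Real.log (N : ℝ) := (Real.lt_log_iff_exp_lt hNpos).mpr hN'
  have hlogpos : 0 < Real.log (N : ℝ) := lt_trans (Real.exp_pos _) hlog
  exact (Real.lt_log_iff_exp_lt hlogpos).mpr hlog

/-- `2 ≤ log N` and `1 ≤ log log N` for `N ≥ 16`. [folklore] -/
private theorem two_le_log_and_one_le_loglog {N : ℕ} (hN : 16 ≤ N) :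
    2 ≤ Real.log (N : ℝ) ∧ 1 ≤ Real.log (Real.log (N : ℝ)) := by
  have hN' : (16 : ℝ) ≤ N := by exact_mod_cast hN
  have hl2 := Real.log_two_gt_d9
  have he := Real.exp_one_lt_d9
  have h16 : Real.log 16 = 4 * Real.log 2 := by
    rw [show (16 : ℝ) = 2 ^ 4 by norm_num, Real.log_pow]; norm_num
  have hlog16 : Real.log 16 ≤ Real.log N := Real.log_le_log (by norm_num) hN'
  have hlogN : 0 < Real.log (N : ℝ) := by linarith
  refine ⟨by linarith, ?_⟩
  rw [Real.le_log_iff_exp_le hlogN]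
  linarith

namespace Pasten2024

/-! ### The engine: `log δ_{1,N} ≤ (1/12) N log log N + O(N)` from a distinguishing prime `≪ (log N)²` -/

/-- **`log δ_{1,N} ≤ (1/12) N log log N + K N` at every level `N ≥ 16` where GRH holds for the
relevant Rankin–Selberg `L`-functions** (Pasten, proof of Thm 7.4 with Thm 7.2's proof, pp. 26–27, at
`D = 1`): Thm 5.5 + `η(c) ≤ (4√p_{f,g})^{#c}` with `p_{f,g} < C (log N)²` (Thm 7.3) give
`log δ_{1,N} ≤ (Σ_{c ≠ [χ₀]} #c)(log 4 + ½ log C + log log N)`, and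
`Σ #c ≤ N/12 + (25/12) d(N)³ √N ≤ N/12 + (25/12) C_d³ N^{3/4}` with `log log N ≤ log N ≤ 4 N^{1/4}`
put everything except `(1/12) N log log N` into `K N`, `K` absolute. Inputs: Thm 7.3 (named fact),
Deligne's bound in weight `2` (named fact), GRH at level `N` (hypothesis); everything else is PROVED
in the tree. [cite: PastenShimura2024, Theorem 7.4 (proof, arXiv p. 27) with Theorem 7.2 (proof, p. 26) and Prop. 7.1] -/
theorem exists_log_modularDegree_le_loglog_of_thm_7_3 (h73 : PastenShimura2024_thm_7_3)
    (hDel : Deligne1974_heckeT_eigenvalue_norm_le) :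
    ∃ K : ℝ, 0 ≤ K ∧ ∀ (N : ℕ) [NeZero N], 16 ≤ N →
      (∀ (M : ℕ) [NeZero M], M ∣ N → ∀ (f : CuspForm (Gamma0 N) 2) (g : CuspForm (Gamma0 M) 2),
          IsNewform0 f → IsNewform0 g → RankinSelbergGRH f f ∧ RankinSelbergGRH f g) →
      ∀ (W : WeierstrassCurve ℚ) [W.IsElliptic] (D : ModularParametrizationData W N),
        (∀ (W' : WeierstrassCurve ℚ) [W'.IsElliptic] (D' : ModularParametrizationData W' N),
            D'.f = D.f → D.modularDegree ≤ D'.modularDegree) →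
          Real.log (D.modularDegree : ℝ) ≤
            (1 / 12 : ℝ) * N * Real.log (Real.log N) +
              K * N := by
  obtain ⟨C, hC1, hC⟩ := h73.exists_distinguishingIndex_le
  obtain ⟨Cd, hCd1, hCd⟩ := Sieve.exists_card_divisors_le_mul_rpow' (ε := 1 / 12) (by norm_num)
  -- `c₀ = log 4 + ½ log C ≥ 0`
  set c₀ : ℝ := Real.log 4 + Real.log C / 2 with hc₀def
  have hlogC : 0 ≤ Real.log C := Real.log_nonneg hC1
  have hc₀ : 0 ≤ c₀ := by
    have : 0 ≤ Real.log 4 := Real.log_nonneg (by norm_num)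
    rw [hc₀def]; linarith
  have hCd0 : 0 ≤ Cd := le_trans zero_le_one hCd1
  refine ⟨c₀ / 12 + 25 / 12 * Cd ^ 3 * (c₀ + 4), by positivity, fun N _ hN hGRH W _ D hmin => ?_⟩
  obtain ⟨hL, hM⟩ := two_le_log_and_one_le_loglog hN
  have hN' : (16 : ℝ) ≤ N := by exact_mod_cast hN
  have hNpos : (0 : ℝ) < N := by linarith
  set L : ℝ := Real.log N with hLdef
  set M : ℝ := Real.log L with hMdef
  -- the engine with `X = C (log N)²`
  have hX := hC N hGRH
  have hmain := log_modularDegree_le_card_mul_of_distinguishingIndex PastenShimura2024_thm_5_5_holds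
    (Deligne1974_heckeT_eigenvalue_norm_le.weight_two hDel) (X := C * Real.log N ^ 2)
    (fun M _ hMN f g hf hg hdiff => hX M hMN f g hf hg hdiff) D hmin
  -- `log X / 2 = ½ log C + log log N`
  have hlogX : Real.log (C * Real.log N ^ 2) / 2 = Real.log C / 2 + M := by
    have hLpos : 0 < L := by linarith
    rw [Real.log_mul (by linarith) (by positivity), Real.log_pow]
    push_cast
    rw [hMdef]
    ring
  rw [hlogX] at hmain
  -- the class count
  set S : ℝ := ∑ P ∈ (finite_minimalPrimes_anemicHeckeRing N 2).toFinset.erase (eigenIdeal D.f),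
      (Module.finrank ℤ (anemicHeckeRing N 2 ⧸ P) : ℝ) with hSdef
  have hS0 : 0 ≤ S := Finset.sum_nonneg fun _ _ => Nat.cast_nonneg _
  set d : ℝ := (N.divisors.card : ℝ) with hddef
  have hd0 : 0 ≤ d := Nat.cast_nonneg _
  have hST : S ≤ (N : ℝ) / 12 + 25 / 12 * d ^ 3 * Real.sqrt N :=
    MurtyPasten.sum_erase_finrank_quotient_le_explicit D
  -- the error term `d³ √N (c₀ + M) ≤ Cd³ (c₀ + 4) N`
  have hd : d ≤ Cd * (N : ℝ) ^ (1 / 12 : ℝ) := hCd N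
  have hd3 : d ^ 3 ≤ Cd ^ 3 * (N : ℝ) ^ (1 / 4 : ℝ) := by
    have h3 : d ^ 3 ≤ (Cd * (N : ℝ) ^ (1 / 12 : ℝ)) ^ 3 := pow_le_pow_left₀ hd0 hd 3
    have hq : ((N : ℝ) ^ (1 / 12 : ℝ)) ^ 3 = (N : ℝ) ^ (1 / 4 : ℝ) := by
      rw [← Real.rpow_natCast, ← Real.rpow_mul hNpos.le]; norm_num
    calc d ^ 3 ≤ (Cd * (N : ℝ) ^ (1 / 12 : ℝ)) ^ 3 := h3
      _ = Cd ^ 3 * ((N : ℝ) ^ (1 / 12 : ℝ)) ^ 3 := by ring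
      _ = Cd ^ 3 * (N : ℝ) ^ (1 / 4 : ℝ) := by rw [hq]
  have hsqrt : Real.sqrt N = (N : ℝ) ^ (1 / 2 : ℝ) := Real.sqrt_eq_rpow _
  have hlogle : L ≤ 4 * (N : ℝ) ^ (1 / 4 : ℝ) := by
    have h := Real.log_le_rpow_div hNpos.le (show (0 : ℝ) < 1 / 4 by norm_num)
    have : (N : ℝ) ^ (1 / 4 : ℝ) / (1 / 4) = 4 * (N : ℝ) ^ (1 / 4 : ℝ) := by ring
    linarith [this ▸ h]
  have hML : M ≤ L := by
    have hLpos : 0 < L := by linarith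
    have := Real.log_le_sub_one_of_pos hLpos
    linarith
  have hq1 : 1 ≤ (N : ℝ) ^ (1 / 4 : ℝ) := Real.one_le_rpow (by linarith) (by norm_num)
  have hrpow : (N : ℝ) ^ (1 / 4 : ℝ) * (N : ℝ) ^ (1 / 2 : ℝ) * (N : ℝ) ^ (1 / 4 : ℝ) = N := by
    rw [← Real.rpow_add hNpos, ← Real.rpow_add hNpos]; norm_num
  have hq2 : 0 ≤ (N : ℝ) ^ (1 / 2 : ℝ) := by positivity
  have herr : d ^ 3 * Real.sqrt N * (c₀ + M) ≤ Cd ^ 3 * (c₀ + 4) * N := by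
    rw [hsqrt]
    have hcM : c₀ + M ≤ (c₀ + 4) * (N : ℝ) ^ (1 / 4 : ℝ) := by nlinarith
    have hcM0 : 0 ≤ c₀ + M := by linarith
    calc d ^ 3 * (N : ℝ) ^ (1 / 2 : ℝ) * (c₀ + M)
        ≤ (Cd ^ 3 * (N : ℝ) ^ (1 / 4 : ℝ)) * (N : ℝ) ^ (1 / 2 : ℝ) * ((c₀ + 4) * (N : ℝ) ^ (1 / 4 : ℝ)) := by
          gcongr
      _ = Cd ^ 3 * (c₀ + 4) * ((N : ℝ) ^ (1 / 4 : ℝ) * (N : ℝ) ^ (1 / 2 : ℝ) * (N : ℝ) ^ (1 / 4 : ℝ)) := by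
          ring
      _ = Cd ^ 3 * (c₀ + 4) * N := by rw [hrpow]
  -- assemble
  have hcM0 : 0 ≤ c₀ + M := by linarith
  calc Real.log (D.modularDegree : ℝ)
      ≤ S * (Real.log 4 + (Real.log C / 2 + M)) := hmain
    _ ≤ ((N : ℝ) / 12 + 25 / 12 * d ^ 3 * Real.sqrt N) * (c₀ + M) := by
        rw [show Real.log 4 + (Real.log C / 2 + M) = c₀ + M by rw [hc₀def]; ring]
        exact mul_le_mul_of_nonneg_right hST hcM0
    _ = (1 / 12 : ℝ) * N * M + c₀ / 12 * N + 25 / 12 * (d ^ 3 * Real.sqrt N * (c₀ + M)) := by ring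
    _ ≤ (1 / 12 : ℝ) * N * M + c₀ / 12 * N + 25 / 12 * (Cd ^ 3 * (c₀ + 4) * N) := by gcongr
    _ = (1 / 12 : ℝ) * N * M + (c₀ / 12 + 25 / 12 * Cd ^ 3 * (c₀ + 4)) * N := by ring

end Pasten2024

/-! ### Thm 7.4 at `D = 1` -/

/-- **Pasten 2024, Theorem 7.4 at `D = 1` (`M = N`, `φ(D)M = N`)** from Thm 7.3: for every `ε > 0`
there is `N₁` such that for every level `N ≥ N₁` at which GRH holds for `L(s, f ⊗ f)` and
`L(s, f ⊗ g)` for all pairs (`f` a newform of level `N`, `g` a newform of level `M ∣ N`) — exactly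
the pairs of the printed proof — and every optimal datum `D` at level `N`
(`D.modularDegree = δ_{1,N}`): `log δ_{1,N} < (1/12 + ε) N log log N`. Printed: "Suppose that the
Generalized Riemann Hypothesis for Rankin–Selberg `L`-functions of modular forms holds. Let `ε > 0`.
Then for `N ≫_ε 1` … `log δ_{D,M} ≤ (1/12 + ε) φ(D) M log log N`." Inputs: the named facts Thm 7.3
and Deligne (weight `2`); PROVED engine `Pasten2024.exists_log_modularDegree_le_loglog_of_thm_7_3`.
[cite: PastenShimura2024, Theorem 7.4 (D = 1; arXiv p. 27)] -/
theorem PastenShimura2024_thm_7_4_levelOne (h73 : PastenShimura2024_thm_7_3)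
    (hDel : Deligne1974_heckeT_eigenvalue_norm_le) {ε : ℝ} (hε : 0 < ε) :
    ∃ N₁ : ℕ, ∀ (N : ℕ) [NeZero N], N₁ ≤ N →
      (∀ (M : ℕ) [NeZero M], M ∣ N → ∀ (f : CuspForm (Gamma0 N) 2) (g : CuspForm (Gamma0 M) 2),
          IsNewform0 f → IsNewform0 g → RankinSelbergGRH f f ∧ RankinSelbergGRH f g) →
      ∀ (W : WeierstrassCurve ℚ) [W.IsElliptic] (D : ModularParametrizationData W N),
        (∀ (W' : WeierstrassCurve ℚ) [W'.IsElliptic] (D' : ModularParametrizationData W' N),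
            D'.f = D.f → D.modularDegree ≤ D'.modularDegree) →
          Real.log (D.modularDegree : ℝ) < (1 / 12 + ε) * (N : ℝ) * Real.log (Real.log N) := by
  obtain ⟨K, hK0, hK⟩ := Pasten2024.exists_log_modularDegree_le_loglog_of_thm_7_3 h73 hDel
  obtain ⟨N₂, hN₂⟩ := exists_nat_lt_loglog (K / ε)
  refine ⟨max 16 N₂, fun N _ hN hGRH W _ D hmin => ?_⟩
  have h16 : 16 ≤ N := le_trans (le_max_left _ _) hN
  have hT : K / ε < Real.log (Real.log (N : ℝ)) := hN₂ N (le_trans (le_max_right _ _) hN)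
  have hmain := hK N h16 hGRH W D hmin
  have hN' : (16 : ℝ) ≤ N := by exact_mod_cast h16
  have hNpos : (0 : ℝ) < N := by linarith
  have hKlt : K < ε * Real.log (Real.log (N : ℝ)) := by
    rw [div_lt_iff₀ hε] at hT; linarith
  have : K * (N : ℝ) < ε * (N : ℝ) * Real.log (Real.log (N : ℝ)) := by nlinarith
  linarith

/-- **Thm 7.4 at `D = 1` under GRH for all Rankin–Selberg `L`-functions of pairs of weight-`2`
newforms** (the global form of the hypothesis of Thm 7.4, "Suppose that GRH for Rankin–Selberg
`L`-functions of modular forms holds"): `log δ_{1,N} < (1/12 + ε) N log log N` for every optimal datum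
at level `N ≥ N₁(ε)`. [cite: PastenShimura2024, Theorem 7.4 (D = 1; arXiv p. 27)] -/
theorem PastenShimura2024_thm_7_4_levelOne_of_grh (h73 : PastenShimura2024_thm_7_3)
    (hDel : Deligne1974_heckeT_eigenvalue_norm_le)
    (hGRH : ∀ (N₁ N₂ : ℕ) [NeZero N₁] [NeZero N₂] (f : CuspForm (Gamma0 N₁) 2)
      (g : CuspForm (Gamma0 N₂) 2), IsNewform0 f → IsNewform0 g → RankinSelbergGRH f g)
    {ε : ℝ} (hε : 0 < ε) :
    ∃ N₁ : ℕ, ∀ (N : ℕ) [NeZero N], N₁ ≤ N →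
      ∀ (W : WeierstrassCurve ℚ) [W.IsElliptic] (D : ModularParametrizationData W N),
        (∀ (W' : WeierstrassCurve ℚ) [W'.IsElliptic] (D' : ModularParametrizationData W' N),
            D'.f = D.f → D.modularDegree ≤ D'.modularDegree) →
          Real.log (D.modularDegree : ℝ) < (1 / 12 + ε) * (N : ℝ) * Real.log (Real.log N) := by
  obtain ⟨N₁, hN₁⟩ := PastenShimura2024_thm_7_4_levelOne h73 hDel hε
  exact ⟨N₁, fun N _ hN W _ D hmin =>
    hN₁ N hN (fun M _ _ f g hf hg => ⟨hGRH N N f f hf hf, hGRH N M f g hf hg⟩) W D hmin⟩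

/-! ### The GRH clauses of Thm 7.5 -/

/-- **Pasten 2024, Theorem 7.5, the GRH clauses** — "Finally, if we assume GRH, for `N ≫_ε 1` with an
effective implicit constant we have `h(E) < (1/24 + ε) N log log N` and
`log |Δ_E| < (1/2 + ε) N log log N`" — PROVED from Thm 7.3 over the tree: under GRH for the
Rankin–Selberg `L`-functions of all pairs of weight-`2` newforms, granted modularity with an integral
Manin constant, Mazur–Kenku and Deligne's weight-`2` bound, for every `ε > 0` there is `N₀` with both
bounds for every elliptic curve `E/ℚ` of conductor `N ≥ N₀` (`h(E)` = `WeierstrassCurve.faltingsHeight`,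
`|Δ_E|` = `minimalDiscriminantNorm ℤ`). The §7.4 deduction: (EqHDeg) `h(E) ≤ ½ log δ_{1,N} + 9`
(`faltingsHeight_le_of_class_bound`, constant `eqHDeg_const_lt`) and (EqDiscH) `log|Δ_E| ≤ 12 h(E) + 16`
(`log_minimalDiscriminantNorm_le_of_modularity'`, `log_minModularDegree_le_of_class_bound`) on a global
minimal model, fed with `Pasten2024.exists_log_modularDegree_le_loglog_of_thm_7_3`.
[cite: PastenShimura2024, Theorem 7.5 (last display, GRH; proof §7.4, arXiv p. 27)] -/
theorem PastenShimura2024_thm_7_5_grh (hmod : nonempty_modularParametrizationData)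
    (h163 : PastenShimura2024_minimalDegree_le_163_mul) (hDel : Deligne1974_heckeT_eigenvalue_norm_le)
    (h73 : PastenShimura2024_thm_7_3)
    (hGRH : ∀ (N₁ N₂ : ℕ) [NeZero N₁] [NeZero N₂] (f : CuspForm (Gamma0 N₁) 2)
      (g : CuspForm (Gamma0 N₂) 2), IsNewform0 f → IsNewform0 g → RankinSelbergGRH f g)
    {ε : ℝ} (hε : 0 < ε) :
    ∃ N₀ : ℕ, ∀ (W : WeierstrassCurve ℚ) [W.IsElliptic], N₀ ≤ W.conductorNorm ℤ →
      W.faltingsHeight <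
          (1 / 24 + ε) * (W.conductorNorm ℤ : ℝ) * Real.log (Real.log (W.conductorNorm ℤ : ℝ)) ∧
        Real.log (W.minimalDiscriminantNorm ℤ : ℝ) <
          (1 / 2 + ε) * (W.conductorNorm ℤ : ℝ) * Real.log (Real.log (W.conductorNorm ℤ : ℝ)) := by
  obtain ⟨K, hK0, hK⟩ := Pasten2024.exists_log_modularDegree_le_loglog_of_thm_7_3 h73 hDel
  obtain ⟨N₂, hN₂⟩ := exists_nat_lt_loglog ((6 * K + 170) / ε)
  refine ⟨max 16 N₂, fun W _ hNW => ?_⟩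
  -- a global minimal model `C • W` (same height, minimal discriminant and conductor)
  obtain ⟨C, hC⟩ := hasGlobalMinimalModel_rat_holds W
  haveI := hC
  have hN : (C • W).conductorNorm ℤ = W.conductorNorm ℤ := conductorNorm_smul_rat W C
  haveI : NeZero ((C • W).conductorNorm ℤ) := ⟨(conductorNorm_pos_holds (C • W)).ne'⟩
  rw [← faltingsHeight_smul W C, ← minimalDiscriminantNorm_smul_rat W C, ← hN]
  have hN16 : 16 ≤ (C • W).conductorNorm ℤ := by rw [hN]; exact le_trans (le_max_left _ _) hNW
  have hNN₂ : N₂ ≤ (C • W).conductorNorm ℤ := by rw [hN]; exact le_trans (le_max_right _ _) hNW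
  set N : ℕ := (C • W).conductorNorm ℤ with hNdef
  obtain ⟨hL, hM⟩ := two_le_log_and_one_le_loglog hN16
  have hT : (6 * K + 170) / ε < Real.log (Real.log (N : ℝ)) := hN₂ N hNN₂
  have hN' : (16 : ℝ) ≤ N := by exact_mod_cast hN16
  set L : ℝ := Real.log N with hLdef
  set M : ℝ := Real.log L with hMdef
  -- the class bound `log δ₀ < B` at level `N` under GRH
  set B : ℝ := (1 / 12 : ℝ) * N * M + K * N + 1 with hBdef
  have hB : ∀ (W₀ : WeierstrassCurve ℚ) [W₀.IsElliptic] (D₀ : ModularParametrizationData W₀ N),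
      (∀ (W'' : WeierstrassCurve ℚ) [W''.IsElliptic] (D'' : ModularParametrizationData W'' N),
          D''.f = D₀.f → D₀.modularDegree ≤ D''.modularDegree) →
        Real.log (D₀.modularDegree : ℝ) < B := fun W₀ _ D₀ hmin => by
    have h1 := hK N hN16 (fun M' _ _ f g hf hg => ⟨hGRH N N f f hf hf, hGRH N M' f g hf hg⟩) W₀ D₀ hmin
    rw [hBdef]
    linarith
  -- (EqHDeg): the height; (EqDiscH): the discriminant
  have hh := faltingsHeight_le_of_class_bound hmod h163 (C • W) hB
  have hc := eqHDeg_const_lt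
  have hΔ := log_minimalDiscriminantNorm_le_of_modularity' hmod (C • W)
  have hmd := log_minModularDegree_le_of_class_bound h163 (hmod (C • W)) hB
  have hl163 : Real.log 163 < 5.55 := by
    have h163 : Real.log 163 ≤ 8 * Real.log 2 := by
      rw [← Real.log_rpow (by norm_num), show ((2 : ℝ) ^ (8 : ℝ)) = 256 by norm_num]
      exact Real.log_le_log (by norm_num) (by norm_num)
    have hl2 := Real.log_two_lt_d9
    linarith
  -- `(6K + 170) N < ε N M` from `M > (6K + 170)/ε`
  have hKlt : 6 * K + 170 < ε * M := by rw [div_lt_iff₀ hε] at hT; linarith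
  have hεNM : (6 * K + 170) * (N : ℝ) < ε * (N : ℝ) * M := by nlinarith
  have hN1 : (1 : ℝ) ≤ N := by linarith
  constructor
  · rw [hBdef] at hh
    nlinarith
  · rw [hBdef] at hmd
    nlinarith

/-! ### The `abc` translation: `log c ≪ rad · log log rad` -/

section Abc

open UniqueFactorizationMonoid IsDedekindDomain

/-- **Frey–Hellegouarch translation of an `N log log N` discriminant bound** (PROVED; the Frey-curve
bookkeeping of Murty–Pasten §8 / Pasten §3 with `log log`): if `log|Δ_min(E)| ≤ A · N_E log log N_E`
for every elliptic `E/ℚ` with `N_E ≥ N₀`, then `log c ≤ (1 + 1024 A) · rad(abc) · log log rad(abc)` for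
every `abc` triple with `c ≥ c₀`. Proof: for the Frey model `W₀` of `exists_frey_model_sq_dvd`,
`2 log c ≤ 8 log 2 + log|Δ_min|` and `N ≤ 2¹⁰ rad`; a prime factor `p ≥ 2 max(N₀ + 2, 512)` of `abc`
(which exists unless all primes of `abc` are small — finitely many triples by Mahler,
`finite_setOf_isABCTriple_primeFactors_subset_holds`, excluded by `c₀`) divides `Δ_min`, hence `N`
(`radical_conductorNorm_eq_holds`), so `N ≥ N₀` and `rad ≥ 1024`; then `N ≤ rad²`,
`log log N ≤ log 2 + log log rad ≤ 2 log log rad` and `4 log 2 ≤ rad · log log rad`.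
[cite: MurtyPasten2013, §8 (proof of Thm 1.2)] [cite: PastenShimura2024, §3 (Frey–Hellegouarch curves) and Theorem 7.5 (GRH clause)] -/
theorem exists_abc_log_le_of_discriminant_loglogBound {A : ℝ} {N₀ : ℕ} (hA : 0 ≤ A)
    (h : ∀ (W : WeierstrassCurve ℚ) [W.IsElliptic], N₀ ≤ W.conductorNorm ℤ →
      Real.log (W.minimalDiscriminantNorm ℤ : ℝ) ≤
        A * (W.conductorNorm ℤ : ℝ) * Real.log (Real.log (W.conductorNorm ℤ : ℝ))) :
    ∃ c₀ : ℝ, ∀ a b c : ℕ, IsABCTriple a b c → c₀ ≤ (c : ℝ) →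
      Real.log c ≤ (1 + 1024 * A) * (rad a b c : ℝ) * Real.log (Real.log (rad a b c : ℝ)) := by
  set M : ℕ := max (N₀ + 2) 512 with hM
  -- Mahler: the triples all of whose primes are `< 2M` form a finite set; bound their `c`
  have hfin := finite_setOf_isABCTriple_primeFactors_subset_holds (Finset.range (2 * M))
  obtain ⟨B, hB⟩ := (hfin.image fun t : ℕ × ℕ × ℕ => t.2.2).bddAbove
  refine ⟨(B : ℝ) + 1, fun a b c ht hc₀ => ?_⟩
  have ht' := ht
  obtain ⟨ha, hb, habc, hcop⟩ := ht'
  have hc : 0 < c := by omega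
  -- a prime factor `p ≥ 2M` of `abc`
  have hnot : ¬ (a * b * c).primeFactors ⊆ Finset.range (2 * M) := by
    intro hsub
    have hmem : c ∈ (fun t : ℕ × ℕ × ℕ => t.2.2) ''
        {t : ℕ × ℕ × ℕ | IsABCTriple t.1 t.2.1 t.2.2 ∧
          (t.1 * t.2.1 * t.2.2).primeFactors ⊆ Finset.range (2 * M)} :=
      ⟨(a, b, c), ⟨ht, hsub⟩, rfl⟩
    have h1 : c ≤ B := hB hmem
    have h2 : (c : ℝ) ≤ B := by exact_mod_cast h1
    linarith
  obtain ⟨p, hp, hpM⟩ := Finset.not_subset.mp hnot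
  have hpP : p.Prime := Nat.prime_of_mem_primeFactors hp
  have hpdvd : p ∣ a * b * c := Nat.dvd_of_mem_primeFactors hp
  have hp2M : 2 * M ≤ p := by simpa [Finset.mem_range] using hpM
  have hM512 : 512 ≤ M := le_max_right _ _
  have hMN₀ : N₀ + 2 ≤ M := le_max_left _ _
  -- `p ≤ rad(abc)`, so `rad ≥ 1024`
  have hprad : p ≤ rad a b c := by
    apply Nat.le_of_mem_primeFactors
    rw [rad_def, Nat.primeFactors_radical]
    exact hp
  have hrad1024 : 1024 ≤ rad a b c := by omega
  -- the Frey model and the discriminant bound at its conductor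
  obtain ⟨W₀, hE, hN, hΔ⟩ := exists_frey_model_sq_dvd ht
  haveI := hE
  have hΔpos : 0 < (W₀.baseChange ℚ).minimalDiscriminantNorm ℤ := minimalDiscriminantNorm_pos_holds _
  have hNpos : 0 < (W₀.baseChange ℚ).conductorNorm ℤ := conductorNorm_pos_holds _
  have hp2 : p ≠ 2 := by omega
  have hpΔ : p ∣ (W₀.baseChange ℚ).minimalDiscriminantNorm ℤ := by
    have h1 : p ∣ 2 ^ 8 * (W₀.baseChange ℚ).minimalDiscriminantNorm ℤ :=
      hpdvd.trans ((dvd_pow_self _ two_ne_zero).trans hΔ)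
    have hcop2 : Nat.Coprime p (2 ^ 8) :=
      Nat.Coprime.pow_right 8 ((Nat.coprime_primes hpP Nat.prime_two).mpr hp2)
    exact hcop2.dvd_of_dvd_mul_left h1
  have hpN : p ∈ ((W₀.baseChange ℚ).conductorNorm ℤ).primeFactors := by
    have hrad := (W₀.baseChange ℚ).radical_conductorNorm_eq_holds
    rw [natRadical_eq_iff] at hrad
    rw [hrad]
    exact Nat.mem_primeFactors.mpr ⟨hpP, hpΔ, hΔpos.ne'⟩
  have hpleN : p ≤ (W₀.baseChange ℚ).conductorNorm ℤ := Nat.le_of_mem_primeFactors hpN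
  have hNge : N₀ ≤ (W₀.baseChange ℚ).conductorNorm ℤ := le_trans (by omega) (hp2M.trans hpleN)
  have hN1024 : 1024 ≤ (W₀.baseChange ℚ).conductorNorm ℤ := le_trans (by omega) (hp2M.trans hpleN)
  have hbound := h (W₀.baseChange ℚ) hNge
  -- real-number bookkeeping
  have hR : (1024 : ℝ) ≤ (rad a b c : ℝ) := by exact_mod_cast hrad1024
  have hN1024' : (1024 : ℝ) ≤ ((W₀.baseChange ℚ).conductorNorm ℤ : ℝ) := by exact_mod_cast hN1024
  have hD0 : (0 : ℝ) < ((W₀.baseChange ℚ).minimalDiscriminantNorm ℤ : ℝ) := by exact_mod_cast hΔpos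
  have hNR : ((W₀.baseChange ℚ).conductorNorm ℤ : ℝ) ≤ 1024 * (rad a b c : ℝ) := by
    have hradpos : 0 < rad a b c := by omega
    have := Nat.le_of_dvd (mul_pos (by positivity) hradpos) hN
    exact_mod_cast this
  have hc2 : (c : ℝ) ^ 2 ≤ 2 ^ 8 * ((W₀.baseChange ℚ).minimalDiscriminantNorm ℤ : ℝ) := by
    have h1 : c ≤ a * b * c := Nat.le_mul_of_pos_left c (by positivity)
    have h2 : (a * b * c) ^ 2 ≤ 2 ^ 8 * (W₀.baseChange ℚ).minimalDiscriminantNorm ℤ :=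
      Nat.le_of_dvd (by positivity) hΔ
    have h3 : c ^ 2 ≤ 2 ^ 8 * (W₀.baseChange ℚ).minimalDiscriminantNorm ℤ :=
      (Nat.pow_le_pow_left h1 2).trans h2
    exact_mod_cast h3
  set N : ℝ := ((W₀.baseChange ℚ).conductorNorm ℤ : ℝ) with hNdef
  set D : ℝ := ((W₀.baseChange ℚ).minimalDiscriminantNorm ℤ : ℝ) with hDdef
  set R : ℝ := (rad a b c : ℝ) with hRdef
  have hl2 := Real.log_two_lt_d9
  have hl2' := Real.log_two_gt_d9
  have hR0 : (0 : ℝ) < R := by linarith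
  have hNpos' : (0 : ℝ) < N := by linarith
  have hlogc : 2 * Real.log c ≤ 8 * Real.log 2 + Real.log D := by
    have h1 : Real.log ((c : ℝ) ^ 2) ≤ Real.log (2 ^ 8 * D) :=
      Real.log_le_log (by positivity) hc2
    rw [Real.log_pow, Real.log_mul (by positivity) hD0.ne', Real.log_pow] at h1
    push_cast at h1
    linarith
  -- `log R ≥ 6.9` (as `R ≥ 1024`), hence `log log R ≥ 1 ≥ log 2`
  have h1024 : Real.log 1024 = 10 * Real.log 2 := by
    rw [show (1024 : ℝ) = 2 ^ 10 by norm_num, Real.log_pow]; norm_num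
  have hlogR : 6.9 ≤ Real.log R := by
    have h1 : Real.log 1024 ≤ Real.log R := Real.log_le_log (by norm_num) hR
    rw [h1024] at h1
    linarith
  have hlogRpos : 0 < Real.log R := by linarith
  have hLLR1 : 1 ≤ Real.log (Real.log R) := by
    rw [Real.le_log_iff_exp_le hlogRpos]
    have he := Real.exp_one_lt_d9
    linarith
  have hLLR : Real.log 2 ≤ Real.log (Real.log R) := by linarith
  have hLLR0 : 0 ≤ Real.log (Real.log R) := by linarith
  -- `log N ≤ 2 log R` (`N ≤ 1024 R ≤ R²`), so `log log N ≤ log 2 + log log R ≤ 2 log log R`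
  have hNR2 : N ≤ R ^ 2 :=
    calc N ≤ 1024 * R := hNR
      _ ≤ R * R := mul_le_mul_of_nonneg_right hR hR0.le
      _ = R ^ 2 := (sq R).symm
  have hlogN : Real.log N ≤ 2 * Real.log R := by
    have h1 : Real.log N ≤ Real.log (R ^ 2) := Real.log_le_log hNpos' hNR2
    have h2 : Real.log (R ^ 2) = 2 * Real.log R := by
      rw [Real.log_pow]; norm_num
    linarith
  have hlogNone : 1 ≤ Real.log N := by
    have h1 : Real.log 1024 ≤ Real.log N := Real.log_le_log (by norm_num) hN1024'
    rw [h1024] at h1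
    linarith
  have hlogNpos : 0 < Real.log N := by linarith
  have hLLN : Real.log (Real.log N) ≤ 2 * Real.log (Real.log R) := by
    calc Real.log (Real.log N) ≤ Real.log (2 * Real.log R) := Real.log_le_log hlogNpos hlogN
      _ = Real.log 2 + Real.log (Real.log R) := Real.log_mul (by norm_num) hlogRpos.ne'
      _ ≤ 2 * Real.log (Real.log R) := by linarith
  have hLLN0 : 0 ≤ Real.log (Real.log N) := Real.log_nonneg hlogNone
  -- `log D ≤ A N log log N ≤ 2048 A R log log R`
  have hD1 : Real.log D ≤ 2 * (1024 * A * (R * Real.log (Real.log R))) := by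
    calc Real.log D ≤ A * N * Real.log (Real.log N) := hbound
      _ ≤ A * (1024 * R) * (2 * Real.log (Real.log R)) := by
          apply mul_le_mul (mul_le_mul_of_nonneg_left hNR hA) hLLN hLLN0
          positivity
      _ = 2 * (1024 * A * (R * Real.log (Real.log R))) := by ring
  -- `4 log 2 ≤ R log log R`
  have h4 : 4 * Real.log 2 ≤ R * Real.log (Real.log R) := by
    have h1 : (1024 : ℝ) * 1 ≤ R * Real.log (Real.log R) := mul_le_mul hR hLLR1 zero_le_one hR0.le
    linarith
  have hmain : Real.log c ≤ 4 * Real.log 2 + 1024 * A * (R * Real.log (Real.log R)) := by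
    linarith
  calc Real.log c ≤ 4 * Real.log 2 + 1024 * A * (R * Real.log (Real.log R)) := hmain
    _ ≤ R * Real.log (Real.log R) + 1024 * A * (R * Real.log (Real.log R)) := by linarith
    _ = (1 + 1024 * A) * R * Real.log (Real.log R) := by ring

/-- **The conditional rung A1.P(GRH): `log c ≪ rad(abc) · log log rad(abc)` under GRH for
Rankin–Selberg `L`-functions** (the cell's idea card a1p-modular-method-rung, "A1.P(GRH): `∃κ c₀,
log c ≤ κ R log log R` from Pasten Thm 7.4"; Pasten §1.3/§7.4: the GRH line of the modular approach to
`abc`). Granted modularity with an integral Manin constant, Mazur–Kenku, Deligne's weight-`2` bound and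
Thm 7.3 (named facts), and ASSUMING GRH for `L(s, f ⊗ g)` for all pairs of weight-`2` newforms
(hypothesis `hGRH`, never asserted): there is `c₀` with `log c ≤ 1537 · rad(abc) · log log rad(abc)` for
every `abc` triple with `c ≥ c₀`. From `PastenShimura2024_thm_7_5_grh` at `ε = 1`
(`log|Δ_E| < (3/2) N log log N`) and `exists_abc_log_le_of_discriminant_loglogBound` (`1 + 1024·3/2`).
Still exponential in `rad(abc)`; no claim on `abc`.
[cite: PastenShimura2024, Theorem 7.5 (GRH clause) with §3 (Frey–Hellegouarch curves), arXiv pp. 13, 27] [cite: MurtyPasten2013, §8] -/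
theorem abc_log_le_mul_rad_mul_loglog_of_grh (hmod : nonempty_modularParametrizationData)
    (h163 : PastenShimura2024_minimalDegree_le_163_mul) (hDel : Deligne1974_heckeT_eigenvalue_norm_le)
    (h73 : PastenShimura2024_thm_7_3)
    (hGRH : ∀ (N₁ N₂ : ℕ) [NeZero N₁] [NeZero N₂] (f : CuspForm (Gamma0 N₁) 2)
      (g : CuspForm (Gamma0 N₂) 2), IsNewform0 f → IsNewform0 g → RankinSelbergGRH f g) :
    ∃ c₀ : ℝ, ∀ a b c : ℕ, IsABCTriple a b c → c₀ ≤ (c : ℝ) →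
      Real.log c ≤ 1537 * (rad a b c : ℝ) * Real.log (Real.log (rad a b c : ℝ)) := by
  obtain ⟨N₀, hN₀⟩ := PastenShimura2024_thm_7_5_grh hmod h163 hDel h73 hGRH one_pos
  have h := exists_abc_log_le_of_discriminant_loglogBound (A := 3 / 2) (N₀ := N₀) (by norm_num)
    (fun W _ hNW => by
      have := (hN₀ W hNW).2
      have h32 : (1 / 2 + 1 : ℝ) = 3 / 2 := by norm_num
      rw [h32] at this
      exact this.le)
  norm_num at h
  exact h

end Abc

end Literature.NumberTheory.EllipticCurves

end
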